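import Mathlib
import Summits.ValiantsHypothesis.ValiantsHypothesis.Theorems.DivisionGapPerMultiplesHardStubRichHostConstantMarginsRaw
import Literature.Computability.AlgebraicComplexity.ArithCircuitProofs
import Literature.Computability.AlgebraicComplexity.PermanentIrreducible

/-!
# `DivisionGap.PerMultiplesHard` (stmt-ValiantsHypothesis-5068), line `uncharged-face-walk`:
stub `stub_richHostConstantMargins` — the rich-host complete-class rung for constant margins

Let `per_G := Σ_{σ inside G} x^{μ_σ}` be the face permanent of a host `G ⊆ [n]²` (`σ` is inside `G`
when `(σ i, i) ∈ G` for every column `i`) and write `#PM(G)` for the number of permutations inside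
`G`.  For every richness scale `K ≥ 1` there are `d, n₀` (depending only on `K`) such that for
`n ≥ n₀`, every RICH host `G` (`n! ≤ K^n · #PM(G)`) and every cofactor `t ∈ ℝ≥0[x_ij]` all of whose
exponents have all row and column margins `q ≥ 1` and whose support contains `q·μ_π` for every
permutation `π` inside `G` satisfy

  `2^{⌊n/d⌋} ≤ L(per_G · t)`                                    (`stub_richHostConstantMargins`)

for the tree's monotone fan-in-two `complexity` `L`.

Proof.
* CLOSED FORM (tree: `RichHostConstantMarginsRaw.stub_richHostConstantMarginsRaw`).  `per_G · t` has
  all margins `q + 1`, `π ↦ (q+1)·μ_π` injects the permutations inside `G` into its pure exponents,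
  and the deep pure count `DeepPureCount.deepPureCount D n _ (q+1)` gives, for `3^{(D+2)²} ≤ n` and
  with `E := 3^{(D+1)²}`, `c := 3^{(D+2)²}`,
  `#PM(G) · 3^{Dn} ≤ (L+1)^E · n! · (n+1)^E · 2^{D(n − ⌊n/3⌋) + c}`.
* ARITHMETIC (`core`, this file).  Multiply by `K^n`, use `n! ≤ K^n · #PM(G)`, cancel `n!` and bound
  `n − ⌊n/3⌋ ≤ n`: `3^{Dn} ≤ K^n (L+1)^E (n+1)^E 2^{Dn + c}`.  With `D := 4K` one has
  `2K · 2^D ≤ 3^D`, so `2^n · K^n · 2^{Dn} ≤ 3^{Dn}` and `2^n ≤ (L+1)^E (n+1)^E 2^c`.  If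
  `L < 2^{⌊n/(4E)⌋}` then `(L+1)^E ≤ 2^{⌊n/4⌋}`, and `(n+1)^E ≤ 2^{⌊n/4⌋}` (`succ_pow_le_two_pow`),
  `2^c ≤ 2^{⌊n/4⌋}` for `n ≥ n₀`, whence `2^n ≤ 2^{3⌊n/4⌋}`, absurd.  So `d := 4E`.
-/

noncomputable section

-- `Summit.ValiantsHypothesis.ValiantsHypothesis.…` is the tree's mandated layout (Sub = Summit).
set_option linter.dupNamespace false

namespace Summit.ValiantsHypothesis.ValiantsHypothesis.Theorems.DivisionGap.PerMultiplesHard.RichHostConstantMargins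

open MvPolynomial Literature.Computability.AlgebraicComplexity
open scoped NNReal BigOperators

/-! ### Growth lemmas in `ℕ` -/

/-- `a · (k + 1) ≤ 2^k` as soon as `k ≥ 2a + 2` (halving: `a ≤ 2^a`, `⌊k/2⌋ + 1 ≤ 2^{⌊k/2⌋}`).
[folklore] -/
theorem mul_succ_le_two_pow (a k : ℕ) (hk : 2 * a + 2 ≤ k) : a * (k + 1) ≤ 2 ^ k := by
  have h1 : k / 2 + 1 ≤ 2 ^ (k / 2) := Nat.lt_two_pow_self
  have h2 : a ≤ 2 ^ a := Nat.lt_two_pow_self.le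
  have h3 : k + 1 ≤ 2 * (k / 2 + 1) := by omega
  calc a * (k + 1) ≤ 2 ^ a * (2 * 2 ^ (k / 2)) :=
        Nat.mul_le_mul h2 (h3.trans (Nat.mul_le_mul_left 2 h1))
    _ = 2 ^ (a + k / 2 + 1) := by ring
    _ ≤ 2 ^ k := Nat.pow_le_pow_right (by norm_num) (by omega)

/-- Polynomial versus exponential: `(n + 1)^E ≤ 2^{⌊n/4⌋}` for `n ≥ 4E(8E + 2)`. [folklore] -/
theorem succ_pow_le_two_pow (E n : ℕ) (hn : 4 * E * (8 * E + 2) ≤ n) :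
    (n + 1) ^ E ≤ 2 ^ (n / 4) := by
  rcases Nat.eq_zero_or_pos E with rfl | hE
  · rw [pow_zero]
    exact Nat.one_le_two_pow
  have h4E : 0 < 4 * E := by omega
  set k := n / (4 * E) with hk
  have hk1 : 8 * E + 2 ≤ k :=
    (Nat.le_div_iff_mul_le h4E).2 (by rw [mul_comm]; exact hn)
  have hn1 : n + 1 ≤ 4 * E * (k + 1) := by
    have h1 := Nat.div_add_mod n (4 * E)
    have h2 := Nat.mod_lt n h4E
    rw [← hk] at h1
    rw [Nat.mul_succ]
    omega
  have hk2 : 4 * E * (k + 1) ≤ 2 ^ k := mul_succ_le_two_pow (4 * E) k (by omega)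
  calc (n + 1) ^ E ≤ (2 ^ k) ^ E := Nat.pow_le_pow_left (hn1.trans hk2) E
    _ = 2 ^ (k * E) := (pow_mul 2 k E).symm
    _ ≤ 2 ^ (n / 4) := Nat.pow_le_pow_right (by norm_num) (by
        rw [hk, ← Nat.div_div_eq_div_mul]
        exact Nat.div_mul_le_self (n / 4) E)

/-- The richness constant: `2K · 2^{4K} ≤ 3^{4K}` for `K ≥ 1` (`2K ≤ 4^K`, `64 ≤ 81`). [folklore] -/
theorem two_mul_mul_two_pow_le (K : ℕ) (hK : 1 ≤ K) : 2 * K * 2 ^ (4 * K) ≤ 3 ^ (4 * K) := by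
  have h1 : 2 * K ≤ 4 ^ K := by
    have := Nat.lt_two_pow_self (n := K)
    calc 2 * K ≤ 2 * 2 ^ K := by omega
      _ = 2 ^ (K + 1) := by ring
      _ ≤ 2 ^ (2 * K) := Nat.pow_le_pow_right (by norm_num) (by omega)
      _ = 4 ^ K := by rw [pow_mul]; norm_num
  calc 2 * K * 2 ^ (4 * K) ≤ 4 ^ K * 2 ^ (4 * K) := Nat.mul_le_mul_right _ h1
    _ = 64 ^ K := by rw [pow_mul, ← mul_pow]; norm_num
    _ ≤ 81 ^ K := Nat.pow_le_pow_left (by norm_num) K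
    _ = 3 ^ (4 * K) := by rw [pow_mul]; norm_num

/-! ### The arithmetic core -/

/-- **Arithmetic core.**  If `K ≥ 1`, `2K · 2^D ≤ 3^D`, `n ≥ 1`, `4c ≤ n`, `4E(8E+2) ≤ n`, the closed form
`P · 3^{Dn} ≤ (L+1)^E · n! · (n+1)^E · 2^{D(n−⌊n/3⌋)+c}` holds and the host is rich
(`n! ≤ K^n · P`), then `2^{⌊n/(4E)⌋} ≤ L`. [folklore] -/
theorem core {K D E c n P L : ℕ} (hK : 1 ≤ K) (hD : 2 * K * 2 ^ D ≤ 3 ^ D) (hn1 : 1 ≤ n)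
    (hnc : 4 * c ≤ n) (hnE : 4 * E * (8 * E + 2) ≤ n)
    (hraw : P * 3 ^ (D * n) ≤
      (L + 1) ^ E * (n.factorial * ((n + 1) ^ E * 2 ^ (D * (n - n / 3) + c))))
    (hrich : n.factorial ≤ K ^ n * P) :
    2 ^ (n / (4 * E)) ≤ L := by
  -- (1) cancel `n!`
  have h3 : 3 ^ (D * n) ≤ K ^ n * ((L + 1) ^ E * ((n + 1) ^ E * 2 ^ (D * n + c))) := by
    have hA : n.factorial * 3 ^ (D * n) ≤
        n.factorial * (K ^ n * ((L + 1) ^ E * ((n + 1) ^ E * 2 ^ (D * (n - n / 3) + c)))) :=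
      calc n.factorial * 3 ^ (D * n) ≤ K ^ n * P * 3 ^ (D * n) := Nat.mul_le_mul_right _ hrich
        _ = K ^ n * (P * 3 ^ (D * n)) := mul_assoc _ _ _
        _ ≤ K ^ n * ((L + 1) ^ E * (n.factorial * ((n + 1) ^ E * 2 ^ (D * (n - n / 3) + c)))) :=
            Nat.mul_le_mul_left _ hraw
        _ = n.factorial * (K ^ n * ((L + 1) ^ E * ((n + 1) ^ E * 2 ^ (D * (n - n / 3) + c)))) := by
            ring
    have hB := Nat.le_of_mul_le_mul_left hA (Nat.factorial_pos n)
    refine hB.trans (Nat.mul_le_mul_left _ (Nat.mul_le_mul_left _ (Nat.mul_le_mul_left _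
      (Nat.pow_le_pow_right (by norm_num) (Nat.add_le_add_right (Nat.mul_le_mul_left D (Nat.sub_le n _)) c)))))
  -- (2) `2^n · K^n · 2^{Dn} ≤ 3^{Dn}`
  have h2 : 2 ^ n * (K ^ n * 2 ^ (D * n)) ≤ 3 ^ (D * n) := by
    calc 2 ^ n * (K ^ n * 2 ^ (D * n)) = (2 * K * 2 ^ D) ^ n := by
          rw [mul_pow, mul_pow, ← pow_mul, mul_assoc]
        _ ≤ (3 ^ D) ^ n := Nat.pow_le_pow_left hD n
        _ = 3 ^ (D * n) := (pow_mul 3 D n).symm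
  -- (3) cancel `K^n · 2^{Dn}`
  have h4 : 2 ^ n ≤ (L + 1) ^ E * ((n + 1) ^ E * 2 ^ c) := by
    have hpos : 0 < K ^ n * 2 ^ (D * n) := Nat.mul_pos (Nat.pow_pos hK) (Nat.pow_pos (by norm_num))
    have hC : (K ^ n * 2 ^ (D * n)) * 2 ^ n ≤
        (K ^ n * 2 ^ (D * n)) * ((L + 1) ^ E * ((n + 1) ^ E * 2 ^ c)) :=
      calc (K ^ n * 2 ^ (D * n)) * 2 ^ n = 2 ^ n * (K ^ n * 2 ^ (D * n)) := mul_comm _ _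
        _ ≤ 3 ^ (D * n) := h2
        _ ≤ K ^ n * ((L + 1) ^ E * ((n + 1) ^ E * 2 ^ (D * n + c))) := h3
        _ = (K ^ n * 2 ^ (D * n)) * ((L + 1) ^ E * ((n + 1) ^ E * 2 ^ c)) := by rw [pow_add]; ring
    exact Nat.le_of_mul_le_mul_left hC hpos
  -- (4) absorb
  by_contra hL
  have hL1 : L + 1 ≤ 2 ^ (n / (4 * E)) := Nat.succ_le_of_lt (not_le.1 hL)
  have hLE : (L + 1) ^ E ≤ 2 ^ (n / 4) :=
    calc (L + 1) ^ E ≤ (2 ^ (n / (4 * E))) ^ E := Nat.pow_le_pow_left hL1 E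
      _ = 2 ^ (n / (4 * E) * E) := (pow_mul _ _ _).symm
      _ ≤ 2 ^ (n / 4) := Nat.pow_le_pow_right (by norm_num) (by
          rw [← Nat.div_div_eq_div_mul]
          exact Nat.div_mul_le_self (n / 4) E)
  have hnE' : (n + 1) ^ E ≤ 2 ^ (n / 4) := succ_pow_le_two_pow E n hnE
  have hc' : 2 ^ c ≤ 2 ^ (n / 4) := Nat.pow_le_pow_right (by norm_num) (by omega)
  have hfin : 2 ^ n ≤ 2 ^ (3 * (n / 4)) :=
    calc 2 ^ n ≤ (L + 1) ^ E * ((n + 1) ^ E * 2 ^ c) := h4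
      _ ≤ 2 ^ (n / 4) * (2 ^ (n / 4) * 2 ^ (n / 4)) :=
          Nat.mul_le_mul hLE (Nat.mul_le_mul hnE' hc')
      _ = 2 ^ (3 * (n / 4)) := by ring
  have := (Nat.pow_le_pow_iff_right (by norm_num : 1 < 2)).1 hfin
  omega

/-! ### The rung -/

/-- **stub_richHostConstantMargins — the rich-host complete-class rung for constant margins.**
For every richness scale `K ≥ 1` there are `d, n₀` such that for `n ≥ n₀`, every rich host `G`
(`n! ≤ K^n · #PM(G)`) and every cofactor `t` all of whose exponents have all row and column
margins `q ≥ 1` and whose support contains `q·μ_π` for every permutation `π` inside `G` satisfy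
`2^{⌊n/d⌋} ≤ L(per_G · t)`.  Constants: `D := 4K`, `E := 3^{(D+1)²}`, `c := 3^{(D+2)²}`,
`d := 4E`, `n₀ := 4E(8E+2) + 4c`.  Proof: the closed form
`RichHostConstantMarginsRaw.stub_richHostConstantMarginsRaw` (Jerrum–Snir-type deep pure count of
`per_G · t`) and the arithmetic `core`. [cite: JerrumSnir1982, §3–4] -/
theorem stub_richHostConstantMargins :
    ∀ K : ℕ, 1 ≤ K → ∃ d n₀ : ℕ, ∀ n ≥ n₀,
      ∀ (G : Finset (Fin n × Fin n)) (t : MvPolynomial (Fin n × Fin n) ℝ≥0) (q : ℕ), 1 ≤ q →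
      n.factorial ≤ K ^ n * ((Finset.univ : Finset (Equiv.Perm (Fin n))).filter (fun σ => ∀ i, (σ i, i) ∈ G)).card →
      (∀ m ∈ t.support, (∀ i, ∑ j, m (i, j) = q) ∧ (∀ j, ∑ i, m (i, j) = q)) →
      (∀ π : Equiv.Perm (Fin n), (∀ i, (π i, i) ∈ G) → q • permMonomial π ∈ t.support) →
      2 ^ (n / d) ≤ complexity ((∑ σ ∈ (Finset.univ : Finset (Equiv.Perm (Fin n))).filter (fun σ => ∀ i, (σ i, i) ∈ G),
            monomial (permMonomial σ) (1 : ℝ≥0)) * t) := by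
  intro K hK
  refine ⟨4 * 3 ^ ((4 * K + 1) ^ 2),
    4 * 3 ^ ((4 * K + 1) ^ 2) * (8 * 3 ^ ((4 * K + 1) ^ 2) + 2) + 4 * 3 ^ ((4 * K + 2) ^ 2), ?_⟩
  intro n hn G t q hq hrich ht hfull
  have hc1 : 1 ≤ 3 ^ ((4 * K + 2) ^ 2) := Nat.one_le_pow _ _ (by norm_num)
  have hnc : 4 * 3 ^ ((4 * K + 2) ^ 2) ≤ n := le_trans (Nat.le_add_left _ _) hn
  have hnE : 4 * 3 ^ ((4 * K + 1) ^ 2) * (8 * 3 ^ ((4 * K + 1) ^ 2) + 2) ≤ n :=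
    le_trans (Nat.le_add_right _ _) hn
  exact core hK (two_mul_mul_two_pow_le K hK) (by omega) hnc hnE
    (RichHostConstantMarginsRaw.stub_richHostConstantMarginsRaw (4 * K) n (by omega) G t q hq ht hfull)
    hrich

end Summit.ValiantsHypothesis.ValiantsHypothesis.Theorems.DivisionGap.PerMultiplesHard.RichHostConstantMargins

end
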